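import Summits.Ventures.CertifiedArithmetic.LowPrec.GemmGridRounding
import Summits.Ventures.CertifiedArithmetic.LowPrec.GemmThetaCertificate
import Summits.Ventures.CertifiedArithmetic.LowPrec.Exact

/-!
# One accumulation step on a dyadic grid: the dictionary for the FP6 θ-certificates

HONEST FRAMING (venture CertifiedArithmetic / cell `pub-lowprec`, seat gemm, gen 7): certified error
envelopes and provably optimal rounding/accumulation schemes for low-precision formats under stated
cost models; every table by two implementations; no hardware or vendor claims.

Glue between the generic soundness theorem `ThetaCertificate.defect_bound` (paper `gemm.tex`
§Regimes Prop. Θ(i)) and the kernel-checked Boolean certificates of the FP6 product alphabets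
(`GemmThetaE3M2*.lean`, grid `2^-8`; E2M3, grid `2^-6`):
* `rne8`: RNE to 8 significant bits of an integer with the binade found by `Nat.log2` (which the
  kernel evaluates natively) instead of the structural search `quarterShift` of `rneQuarter`;
  `rne8_eq_rneQuarter` below `2^32`, so `toRat_roundNE_BFloat16_dyadic` reads `fl_bf16(K/2^g) = rne8 K/2^g`.
  Measured: a 32-state chunk of the E3M2² certificate checks in 56 s with `rne8` against 79 s.
* `flStep_dyadic`, `gainOf_dyadic`, `deficitOf_dyadic`, `dyadic_eq_iff`: one step, its gain and
  deficit in grid units.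
* `toRat_mul_toRat_E3M2` / `_E2M3`: a product of two data is `toInt a · toInt b` grid units
  (`Exact.toRat_mul_toRat`); for E3M2² the grid is `2^-8`, for E2M3² it is `2^-6`.
-/

namespace Literature.ComputerArithmetic.FloatingPoint

namespace MiniFloat

open Format

/-! ### RNE to 8 significant bits with a native binade search -/

/-- Magnitude part: `n < 2^8` is exact, else round the pattern `n` to 8 bits in the binade
`log₂ n - 7`. [cite: IEEE7542019, §4.3.1] -/
def rne8Mag (n : ℕ) : ℕ :=
  if n < 256 then n else rneShiftNat n (Nat.log2 n - 7) * 2 ^ (Nat.log2 n - 7)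

/-- `rne8 K`: round-to-nearest-even to 8 significant bits of the integer `K` (sign kept); equal to
`rneQuarter K` (`rne8_eq_rneQuarter`), cheaper in the kernel. [cite: IEEE7542019, §4.3.1] -/
def rne8 (K : ℤ) : ℤ :=
  if K < 0 then -((rne8Mag K.natAbs : ℕ) : ℤ) else ((rne8Mag K.natAbs : ℕ) : ℤ)

/-- The two binade searches agree: `log₂ n - 7 = quarterShift n 24` for `2^8 ≤ n < 2^32`. [folklore] -/
theorem log2_sub_eq_quarterShift {n : ℕ} (h1 : 256 ≤ n) (h2 : n < 2 ^ 32) :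
    Nat.log2 n - 7 = quarterShift n 24 := by
  obtain ⟨hlo, hhi⟩ := quarterShift_spec 24 n h1 h2
  have hn : n ≠ 0 := by omega
  have hA : 2 ^ Nat.log2 n ≤ n := Nat.log2_self_le hn
  have hB : n < 2 ^ (Nat.log2 n + 1) := Nat.lt_log2_self
  have e : Nat.log2 n = 7 + quarterShift n 24 := by
    by_contra hne
    rcases Nat.lt_or_gt_of_ne hne with hlt | hgt
    · have := Nat.pow_le_pow_right (by norm_num : 0 < 2)
        (show Nat.log2 n + 1 ≤ 7 + quarterShift n 24 by omega)
      omega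
    · have := Nat.pow_le_pow_right (by norm_num : 0 < 2)
        (show 7 + quarterShift n 24 + 1 ≤ Nat.log2 n by omega)
      omega
  omega

/-- `rne8 = rneQuarter` below `2^32`. [folklore] -/
theorem rne8_eq_rneQuarter {K : ℤ} (hK : K.natAbs < 2 ^ 32) : rne8 K = rneQuarter K := by
  have hm : rne8Mag K.natAbs = rneQuarterMag K.natAbs := by
    unfold rne8Mag rneQuarterMag
    by_cases hn : K.natAbs < 256
    · rw [if_pos hn, if_pos hn]
    · rw [if_neg hn, if_neg hn, log2_sub_eq_quarterShift (not_lt.mp hn) hK]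
  unfold rne8 rneQuarter
  rw [hm]

/-! ### One step, gain and deficit in grid units -/

/-- Grid equalities are integer equalities. [folklore] -/
theorem dyadic_eq_iff {g : ℕ} {a b : ℤ} : (a : ℚ) / 2 ^ g = (b : ℚ) / 2 ^ g ↔ a = b := by
  rw [div_left_inj' (by positivity : (2 : ℚ) ^ g ≠ 0), Int.cast_inj]

/-- `fl_bf16(V/2^g + Q/2^g) = rne8(V + Q)/2^g`. [cell; GemmGridRounding] -/
theorem flStep_dyadic {g : ℕ} (hg : g ≤ 133) {V Q : ℤ} (h : (V + Q).natAbs < 2 ^ 32) :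
    flStep Format.BFloat16 ((V : ℚ) / 2 ^ g) ((Q : ℚ) / 2 ^ g) = (rne8 (V + Q) : ℚ) / 2 ^ g := by
  unfold flStep
  rw [show (V : ℚ) / 2 ^ g + (Q : ℚ) / 2 ^ g = ((V + Q : ℤ) : ℚ) / 2 ^ g by push_cast; ring]
  rw [rne8_eq_rneQuarter h]; exact toRat_roundNE_BFloat16_dyadic hg (V + Q) h

/-- The gain in grid units. [cell] -/
theorem gainOf_dyadic {g : ℕ} (hg : g ≤ 133) {V Q : ℤ} (h : (V + Q).natAbs < 2 ^ 32) :
    gainOf Format.BFloat16 ((V : ℚ) / 2 ^ g) ((Q : ℚ) / 2 ^ g)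
      = ((rne8 (V + Q) - V - Q : ℤ) : ℚ) / 2 ^ g := by
  unfold gainOf; rw [flStep_dyadic hg h]; push_cast; ring

/-- The deficit in grid units. [cell] -/
theorem deficitOf_dyadic {g : ℕ} (hg : g ≤ 133) {V Q : ℤ} (h : (V + Q).natAbs < 2 ^ 32) :
    deficitOf Format.BFloat16 ((V : ℚ) / 2 ^ g) ((Q : ℚ) / 2 ^ g)
      = (((Q.natAbs : ℤ) - (rne8 (V + Q) - V - Q) : ℤ) : ℚ) / 2 ^ g := by
  unfold deficitOf
  rw [gainOf_dyadic hg h, abs_div, abs_of_pos (by positivity : (0 : ℚ) < 2 ^ g), ← Int.cast_abs,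
    ← Int.natCast_natAbs]
  push_cast; ring

/-! ### Products of minifloat data are integers on the product grid -/

/-- `qexp(E3M2) = -4`: E3M2·E3M2 products live on the grid `2^-8`. [cite: RouhaniEtAl2023MX, Table 1] -/
theorem E3M2_qexp_add : Format.E3M2.qexp + Format.E3M2.qexp = -8 := by decide

/-- `qexp(E2M3) = -3`: E2M3·E2M3 products live on the grid `2^-6`. [cite: RouhaniEtAl2023MX, Table 1] -/
theorem E2M3_qexp_add : Format.E2M3.qexp + Format.E2M3.qexp = -6 := by decide

/-- An E3M2·E3M2 product in grid units: `a · b = (toInt a · toInt b) / 2^8`. [folklore] -/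
theorem toRat_mul_toRat_E3M2 (a b : MiniFloat Format.E3M2) :
    a.toRat * b.toRat = ((a.toInt * b.toInt : ℤ) : ℚ) / 2 ^ 8 := by
  rw [toRat_mul_toRat, E3M2_qexp_add, zpow_neg, div_eq_mul_inv]; norm_cast

/-- An E2M3·E2M3 product in grid units: `a · b = (toInt a · toInt b) / 2^6`. [folklore] -/
theorem toRat_mul_toRat_E2M3 (a b : MiniFloat Format.E2M3) :
    a.toRat * b.toRat = ((a.toInt * b.toInt : ℤ) : ℚ) / 2 ^ 6 := by
  rw [toRat_mul_toRat, E2M3_qexp_add, zpow_neg, div_eq_mul_inv]; norm_cast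

end MiniFloat

end Literature.ComputerArithmetic.FloatingPoint
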